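import Mathlib
import Summits.ResolutionOfSingularities.ResolutionOfSingularities.Theorems.WeightedInvariantLocalWeightedDropNCPolyBridgeCurveMove
import Summits.ResolutionOfSingularities.ResolutionOfSingularities.Theorems.WeightedInvariantLocalWeightedDropPolyDescentBridge
import Summits.ResolutionOfSingularities.ResolutionOfSingularities.Theorems.WeightedInvariantLocalWeightedDropPolyDescentPrepExists

/-!
# `WeightedInvariant.LocalWeightedDrop`, TOT2-LINE piece S-E2′ (the count-game bridge), part 3: FREE SHEARS AND PREPARATIONS, and THE DISPATCH —
# one legal count move per represented label whose successors represent `PolyDescent.succT`-successors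

Crux item stmt-ResolutionOfSingularities-8899 `LocalWeightedDrop` (route `ResolutionOfSingularities/WeightedInvariant`), ENGINE skeleton v32
(ddb48572591139d5), registered stub `stub_spaceNCRankDrop`; TOT2-LINE v1.1 §(E) piece S-E2′ (`L/res-L1-w43-lead-1/g4/TOT2-LINE.md`).
[OURS · L1 W4.3 · chain w43 · lead-1 gen 4.  The count-game form of the dispatch T-6′_d `PolyDescent.stub_polyBridge` (res-D-pv-058 AS stub-6 with
res-type-061, …PolyDescentBridge): the same case analysis, with `CobordantGame.Won` replaced by «the successor represents the successor label» and
the boundary carried along.  MODEL: Cossart–Jannsen–Saito LNM 2270 Ch. 8/11/13 (strategy for `J = (y^d + Σ A_j y^j)`); Perlega arXiv:2011.14443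
§7.  Nothing here is a statement of any manuscript; the games are the programme's own.  AI-produced, gate-checked, weaker than expert review.]

* `Represents.shear` — the `u₂`-shear `u₂ ↦ u₂ + u₁h` is free OFF the conflict (`u₂ ∉ N`): `Represents b d A N → Represents b d (shearT h A) N`;
* `Represents.prep` — preparation is free (ρ-P `stub_polyPrep` + `Represents.shift`);
* `pointMove_succ_of_represents` — the point branch with re-preparation: successors are unit × monomial or represent a member of
  `{blowOneT A, blowTwoT A} ∪ {blowOneT (prep (shearT λ A)) : λ ≠ 0}` (`PolyDescent.blowOneT_shift`); no boundary hypothesis (the conflict move too);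
* **`succMove_of_represents`** — THE DISPATCH: outside the conflict states, from a represented positive label one legal count move has every
  successor unit × monomial or representing some `A′ ∈ PolyDescent.succT d A`: (a′) curve moves, (a″) shear + prepare + row transfer + curve move,
  (b) the point move.
RELATION TO res-L1-w43-stub-2's …TOT2Bridge{Point,Curve,Labels,Decorated} (S-E2 (E2-c), same day): those give the same move clauses on DRESSED
monic forms `b∘Φ₀ = U·P·∏ letters` with `Φ₀` explicit and the δ-adapter to S-SET; here `Φ₀` is hidden in `NCPoly.Represents` and the successor
label is named directly.  The decorated assembly uses theirs; this file closes the `Represents`-packaged regime theorem (…NCPolyBridgeExit).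
-/

set_option linter.dupNamespace false -- mandated namespace of this single-conjunct summit

noncomputable section

namespace Summit.ResolutionOfSingularities.ResolutionOfSingularities.Theorems

namespace NCPoly

open MvPowerSeries Literature.AlgebraicGeometry.Resolution TameFourTupleDrop

variable {k : Type} [Field k]

/-! ## The `u₂`-shear is free off the boundary plane `u₂ = 0` -/

/-- `rename` of `X 0` from the plane is `X 0`. -/
theorem rename_X_zero : rename (Fin.succAboveEmb (Fin.last 2)) (X 0 : MvPowerSeries (Fin 2) k) = (X 0 : MvPowerSeries (Fin 3) k) := by
  rw [rename_X]; rfl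

/-- **THE SHEAR IS FREE when `u₂ ∉ N`.**  If `b` represents `A` with boundary `N ∌ u₂`, it represents the sheared label `shearT h A`
(`u₂ ↦ u₂ + u₁ h`) with the same boundary: the shear fixes `u₁` and the plane `u₁ = 0`.  (With `u₂ ∈ N` this fails — the CONFLICT states of
the TOT2-LINE, where the strategy deviates to the point move.) -/
theorem Represents.shear {b : MvPowerSeries (Fin 3) k} {d : ℕ} {A : Fin d → MvPowerSeries (Fin 2) k} {N : Finset (Fin 2)}
    (hrep : Represents b d A N) (h1N : (1 : Fin 2) ∉ N) (h : MvPowerSeries (Fin 2) k) : Represents b d (PolyDescent.shearT h A) N := by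
  classical
  obtain ⟨Θ, U, hΘ0, hdet, hU, hb⟩ := hrep
  have hθ0 := MonicDescent.constantCoeff_shearFamily h
  have hE0 := constantCoeff_extendLast' _ hθ0
  have hEs := hasSubst_of_constantCoeff_zero hE0
  refine ⟨fun i => subst (extendLast ![X 0, X 1 + X 0 * h]) (Θ i), subst (extendLast ![X 0, X 1 + X 0 * h]) U,
    fun i => constantCoeff_comp_eq_zero hΘ0 hE0 i, ?_, ?_, ?_⟩
  · change IsUnit (FormalCoordChange.linMat (fun i => subst (extendLast ![X 0, X 1 + X 0 * h]) (Θ i))).det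
    rw [linMat_comp Θ hE0, Matrix.det_mul, det_linMat_extendLast]
    exact hdet.mul (PureDescent.isUnit_det_shearFamily h)
  · rw [constantCoeff_subst_of_constantCoeff_zero _ hE0]; exact hU
  · have hsh : (fun j => subst ![X 0, X 1 + X 0 * h] (A j)) = PolyDescent.shearT h A :=
      funext fun j => (MonicDescent.shear_eq h (A j)).symm
    have hbd : subst (extendLast ![X 0, X 1 + X 0 * h]) (bdry N : MvPowerSeries (Fin 3) k) = bdry N := by
      rw [bdry_eq, if_neg h1N, mul_one]
      split_ifs
      · rw [subst_X hEs, extendLast_zero, Matrix.cons_val_zero, rename_X_zero]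
      · rw [← coe_substAlgHom hEs, map_one]
    rw [← subst_subst_eq_subst_comp hΘ0 hE0, hb, ← coe_substAlgHom hEs, map_mul, map_mul, coe_substAlgHom,
      subst_extendLast_monicGerm _ hθ0, hsh, hbd]

/-- **PREPARATION IS FREE**: a represented positive label may be replaced by its preparation `prep d A` (ρ-P `stub_polyPrep` supplies the
well-preparing re-centring; `Represents.shift`). -/
theorem Represents.prep {b : MvPowerSeries (Fin 3) k} {d : ℕ} (hd : 0 < d) {A : Fin d → MvPowerSeries (Fin 2) k} {N : Finset (Fin 2)}
    (hrep : Represents b d A N) (hpos : PolyDescent.IsPosT d A) : Represents b d (PolyDescent.prep d A) N :=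
  hrep.shift (PolyDescent.isPrepRecentring_prepPsi (PolyDescent.stub_polyPrep k d hd A hpos)).1

/-! ## THE DISPATCH: one count move per represented label, successors represent `succT`-successors -/

/-- THE POINT BRANCH with re-preparation: from a represented positive label the point move yields successors that are unit × monomial or represent
a member of the point branch `{blowOneT A, blowTwoT A} ∪ {blowOneT (prep (shearT λ A)) : λ ≠ 0}` of `PolyDescent.succT` (the `λ`-sheared
label re-prepared for free: `PolyDescent.blowOneT_shift`, `Represents.shift`).  No hypothesis on the boundary: this is also the move of the
strategy at the CONFLICT states. -/
theorem pointMove_succ_of_represents {d : ℕ} (hd : 0 < d) {A : Fin d → MvPowerSeries (Fin 2) k} (hpos : PolyDescent.IsPosT d A)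
    {b : MvPowerSeries (Fin 3) k} {N : Finset (Fin 2)} (hrep : Represents b d A N) :
    ∃ Φ : Fin 3 → MvPowerSeries (Fin 3) k, IsCountMove (m := 2) Φ (fun _ => 1) ∧
      MoveClause (m := 2) b Φ (fun _ => 1) (fun b' => IsStdNC b' ∨
        ∃ A' ∈ ({PolyDescent.blowOneT d A, PolyDescent.blowTwoT d A} ∪
            {B | ∃ c : k, c ≠ 0 ∧ B = PolyDescent.blowOneT d (PolyDescent.prep d (PolyDescent.shearT (C c) A))} :
              Set (Fin d → MvPowerSeries (Fin 2) k)),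
          ∃ N' : Finset (Fin 2), Represents b' d A' N') := by
  classical
  have hprep := PolyDescent.stub_polyPrep k d hd
  obtain ⟨Φ, hmv, hcl⟩ := pointMove_of_represents hpos hrep
  refine ⟨Φ, hmv, hcl.mono fun b' hb' => hb'.imp_right ?_⟩
  rintro ⟨c, -, (⟨-, h⟩ | ⟨-, -, h⟩)⟩
  · by_cases hl : c 1 / c 0 = 0
    · have hsh : PolyDescent.shearT (C (c 1 / c 0)) A = A := by
        funext j; rw [hl, map_zero]; exact MonicDescent.shear_zero_eq (A j)
      rw [hsh] at h
      exact ⟨_, Set.mem_union_left _ (Set.mem_insert _ _), _, h⟩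
    · have hposY : PolyDescent.IsPosT d (PolyDescent.shearT (C (c 1 / c 0)) A) := PolyDescent.isPosT_shearT _ hpos
      obtain ⟨hχ0, hposB, -, -⟩ := PolyDescent.isPrepRecentring_prepPsi (hprep _ hposY)
      have hχ1 : (1 : ℕ∞) ≤ (PolyDescent.prepPsi d (PolyDescent.shearT (C (c 1 / c 0)) A)).order := nat_le_order fun e he => by
        have he0 : e = 0 := by
          have : e.degree = 0 := by exact_mod_cast Nat.lt_one_iff.mp (by exact_mod_cast he)
          exact (Finsupp.degree_eq_zero_iff e).mp this
        rw [he0, coeff_zero_eq_constantCoeff_apply, hχ0]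
      have hcomm := PolyDescent.blowOneT_shift (PolyDescent.shearT (C (c 1 / c 0)) A) _ (fun j => (hposY j).le) hχ1
      have hchi1 : constantCoeff (MonicDescent.blowOne 1 (PolyDescent.prepPsi d (PolyDescent.shearT (C (c 1 / c 0)) A))) = 0 := by
        rw [MonicDescent.constantCoeff_blowOne_one_eq]
        exact PolyDescent.coeff_single_one_eq_zero_of_isPosT_shift hd hposY hχ0 hposB 0
      refine ⟨_, Set.mem_union_right _ ⟨c 1 / c 0, hl, rfl⟩, insert 0 (N.filter fun l => l = 1 ∧ c 1 = 0), ?_⟩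
      rw [PolyDescent.prep, hcomm]
      exact h.shift hchi1
  · exact ⟨_, Set.mem_union_left _ (Set.mem_insert_of_mem _ rfl), _, h⟩

/-- **THE DISPATCH of the count-game bridge** (the count-game form of T-6′_d `PolyDescent.stub_polyBridge`).  From a position `b` representing a
positive label `A` with boundary `N`, outside the CONFLICT states (a graph-curve step with `u₂ ∈ N`), one legal count move — the move of the
polyhedron strategy Σ**_d read in the representing coordinates — has every successor unit × monomial or representing a successor label
`A′ ∈ PolyDescent.succT d A` (with some boundary): (a′) `V(y,u₁)` / `V(y,u₂)` permissible ⇒ the curve move (`curveMoveZero/One_of_represents`);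
(a″) a graph curve ⇒ shear (free off `u₂ ∈ N`), prepare (free), row transfer (`isPermissibleTwoT_of_wellPrepared_of_isPermissibleTwoT_shift`), then
the curve move `V(y,ũ₂)`; (b) otherwise the point move (`pointMove_succ_of_represents`). -/
theorem succMove_of_represents {d : ℕ} (hd : 0 < d) {A : Fin d → MvPowerSeries (Fin 2) k} (hpos : PolyDescent.IsPosT d A)
    {b : MvPowerSeries (Fin 3) k} {N : Finset (Fin 2)} (hrep : Represents b d A N)
    (hconf : ¬ PolyDescent.IsPermissibleOneT d A → ¬ PolyDescent.IsPermissibleTwoT d A → PolyDescent.HasGraphCurveT d A → (1 : Fin 2) ∉ N) :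
    ∃ (Φ : Fin 3 → MvPowerSeries (Fin 3) k) (w : Fin 3 → ℕ), IsCountMove (m := 2) Φ w ∧
      MoveClause (m := 2) b Φ w (fun b' => IsStdNC b' ∨ ∃ A' ∈ PolyDescent.succT d A, ∃ N' : Finset (Fin 2), Represents b' d A' N') := by
  classical
  have hprep := PolyDescent.stub_polyPrep k d hd
  by_cases h1 : PolyDescent.IsPermissibleOneT d A
  · -- (a′) the curve `V(y,u₁)`
    obtain ⟨Φ, hmv, hcl⟩ := curveMoveZero_of_represents hpos (fun j => PolyDescent.eq_X_pow_mul_divOneT h1 j) hrep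
    refine ⟨Φ, _, hmv, hcl.mono fun b' hb' => hb'.imp_right fun h => ⟨PolyDescent.divOneT d A, ?_, _, h⟩⟩
    rw [PolyDescent.succT_of_isPermissibleOneT h1]; exact Set.mem_singleton _
  by_cases h2 : PolyDescent.IsPermissibleTwoT d A
  · -- (a′) the curve `V(y,u₂)`
    obtain ⟨Φ, hmv, hcl⟩ := curveMoveOne_of_represents hpos (fun j => PolyDescent.eq_X_pow_mul_divTwoT h2 j) hrep
    refine ⟨Φ, _, hmv, hcl.mono fun b' hb' => hb'.imp_right fun h => ⟨PolyDescent.divTwoT d A, ?_, _, h⟩⟩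
    rw [PolyDescent.succT_of_isPermissibleTwoT h1 h2]; exact Set.mem_singleton _
  by_cases h3 : PolyDescent.HasGraphCurveT d A
  · -- (a″) a graph curve: shear (free off the conflict), prepare (free), row transfer, then the curve `V(y, ũ₂)`
    have h1N := hconf h1 h2 h3
    obtain ⟨ψ, -, -, hperm⟩ := PolyDescent.graphShearT_spec h3
    set Y := PolyDescent.shearT (PolyDescent.graphShearT d A) A with hY
    have hposY : PolyDescent.IsPosT d Y := PolyDescent.isPosT_shearT _ hpos
    obtain ⟨hχ0, hposB, hWPB, -⟩ := PolyDescent.isPrepRecentring_prepPsi (hprep Y hposY)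
    have hBdef : PolyDescent.prep d Y = WildMonic.shift d Y (PolyDescent.prepPsi d Y) := rfl
    have hpermB : PolyDescent.IsPermissibleTwoT d (PolyDescent.prep d Y) := by
      refine PolyDescent.isPermissibleTwoT_of_wellPrepared_of_isPermissibleTwoT_shift hd hWPB (φ := ψ - PolyDescent.prepPsi d Y) ?_
      rw [hBdef, PolyDescent.shift_shift, sub_add_cancel]
      exact hperm
    have hrepB : Represents b d (PolyDescent.prep d Y) N := (hrep.shear h1N _).shift hχ0
    obtain ⟨Φ, hmv, hcl⟩ := curveMoveOne_of_represents (hBdef ▸ hposB) (fun j => PolyDescent.eq_X_pow_mul_divTwoT hpermB j) hrepB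
    refine ⟨Φ, _, hmv, hcl.mono fun b' hb' => hb'.imp_right fun h => ⟨PolyDescent.divTwoT d (PolyDescent.prep d Y), ?_, _, h⟩⟩
    rw [PolyDescent.succT_of_hasGraphCurveT h1 h2 h3]; exact Set.mem_singleton _
  · -- (b) the point
    obtain ⟨Φ, hmv, hcl⟩ := pointMove_succ_of_represents hd hpos hrep
    refine ⟨Φ, _, hmv, hcl.mono fun b' hb' => hb'.imp_right ?_⟩
    rintro ⟨A', hA', N', h⟩
    exact ⟨A', by rw [PolyDescent.succT_of_point h1 h2 h3]; exact hA', N', h⟩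

end NCPoly

end Summit.ResolutionOfSingularities.ResolutionOfSingularities.Theorems

end
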